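import Mathlib.RingTheory.Polynomial.UniqueFactorization
import Mathlib.RingTheory.MvPolynomial.IrreducibleQuadratic
import Mathlib.RingTheory.Ideal.Maximal
import Mathlib.Tactic.Ring
import Mathlib.Tactic.NormNum
import HarnessLib

/-!
# Primality of the strict transform `g₃` of the threefold germ

Support file for crux stmt-ResolutionOfSingularities-15315
(`FrobeniusLadder.FInjectiveMacaulayfication`, line `Sketch`, lead seat c7, cycle 8): stub
`stub_threefoldG3Prime` of the §13 THREEFOLD CALIBRATION package. The germ
`f = X₀²X₁ + X₁²X₂ + X₂²X₀ + X₀X₃³ + X₁X₂X₃²` in `k[X₀,X₁,X₂,X₃]` has, on the `X₃`-chart of the point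
blow-up, the strict transform

  `g₃ = X₀²X₁ + X₁²X₂ + X₂²X₀ + X₀X₃ + X₁X₂X₃ = a · X₃ + c`,
  `a = X₀ + X₁X₂`, `c = X₀²X₁ + X₁²X₂ + X₂²X₀ ∈ k[X₀,X₁,X₂]`.

This file proves that `(g₃)` is a prime ideal over EVERY field `k` (no characteristic hypothesis);
the other primality statements of the calibration are transferred from this one elsewhere.

Proof. `g₃` is linear in `X₃` with coefficients `a`, `c` not involving `X₃`, so by
`MvPolynomial.irreducible_mul_X_add` (Mathlib: a primitive linear polynomial over a domain is
irreducible) it suffices that `a` and `c` be relatively prime. Now `a = 1 · X₀ + X₁X₂` is itself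
linear in `X₀` with coprime coefficients, hence irreducible, so `IsRelPrime a c ↔ a ∤ c`
(`Irreducible.isRelPrime_iff_not_dvd`); and `a ∤ c` because the evaluation
`(X₀,X₁,X₂,X₃) ↦ (-1,1,1,0)` kills `a` but sends `c` to `1 + 1 - 1 = 1`. Finally `k[X₀,…,X₃]` is a
UFD, so irreducible = prime, and `Ideal.span_singleton_prime` concludes.

The small `notMem_vars_*` lemmas certify syntactically that a variable does not occur in a sum /
product / power / other variable (`MvPolynomial.vars_add_subset`, `vars_mul`, `vars_pow`, `vars_X`).

References: the algebra is folklore (Gauss: a primitive polynomial of degree one is irreducible).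
-/

-- single-problem summit: the doubled namespace component is forced
set_option linter.dupNamespace false

namespace Summit.ResolutionOfSingularities.ResolutionOfSingularities.Theorems.FInjectiveMacaulayfication.ThreefoldG3Prime

open MvPolynomial

section Vars

variable {σ R : Type*} [CommSemiring R]

/-- A variable occurring neither in `p` nor in `q` does not occur in `p + q`
(`MvPolynomial.vars_add_subset`). [folklore] -/
theorem notMem_vars_add [DecidableEq σ] {i : σ} {p q : MvPolynomial σ R} (hp : i ∉ p.vars)
    (hq : i ∉ q.vars) : i ∉ (p + q).vars := fun h =>
  (Finset.mem_union.mp (vars_add_subset p q h)).elim hp hq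

/-- A variable occurring neither in `p` nor in `q` does not occur in `p * q`
(`MvPolynomial.vars_mul`). [folklore] -/
theorem notMem_vars_mul [DecidableEq σ] {i : σ} {p q : MvPolynomial σ R} (hp : i ∉ p.vars)
    (hq : i ∉ q.vars) : i ∉ (p * q).vars := fun h =>
  (Finset.mem_union.mp (vars_mul p q h)).elim hp hq

/-- A variable not occurring in `p` does not occur in `p ^ n` (`MvPolynomial.vars_pow`).
[folklore] -/
theorem notMem_vars_pow {i : σ} {p : MvPolynomial σ R} (hp : i ∉ p.vars) (n : ℕ) :
    i ∉ (p ^ n).vars := fun h => hp (vars_pow p n h)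

/-- The variable `X j` involves no variable `i ≠ j` (`MvPolynomial.vars_X`). [folklore] -/
theorem notMem_vars_X [Nontrivial R] {i j : σ} (h : i ≠ j) :
    i ∉ (X j : MvPolynomial σ R).vars := by
  rw [vars_X, Finset.mem_singleton]
  exact h

end Vars

/-- **Primality of `g₃`** (registered stub `stub_threefoldG3Prime` of the §13 threefold
calibration): over any field `k`, the ideal of `k[X₀,X₁,X₂,X₃]` generated by
`g₃ = X₀²X₁ + X₁²X₂ + X₂²X₀ + X₀X₃ + X₁X₂X₃` is prime. Proof: `g₃ = (X₀ + X₁X₂)·X₃ + c` with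
`c = X₀²X₁ + X₁²X₂ + X₂²X₀`, linear in `X₃`; `X₀ + X₁X₂` is irreducible (linear in `X₀`, primitive)
and does not divide `c` (evaluate at `(-1,1,1,0)`: `0 ∤ 1`), so the coefficients are relatively
prime and `MvPolynomial.irreducible_mul_X_add` gives irreducibility, i.e. primality in the UFD
`k[X₀,…,X₃]`. [folklore] -/
theorem stub_threefoldG3Prime : ∀ (k : Type) [Field k] (g₃ : MvPolynomial (Fin 4) k),
    g₃ = MvPolynomial.X 0 ^ 2 * MvPolynomial.X 1 + MvPolynomial.X 1 ^ 2 * MvPolynomial.X 2 + MvPolynomial.X 2 ^ 2 * MvPolynomial.X 0 + MvPolynomial.X 0 * MvPolynomial.X 3 + MvPolynomial.X 1 * MvPolynomial.X 2 * MvPolynomial.X 3 →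
    (Ideal.span {g₃}).IsPrime := by
  intro k _ g₃ hg
  -- `g₃ = a · X₃ + c` is linear in `X₃`
  have hlin : g₃ = (X 0 + X 1 * X 2) * X 3 + (X 0 ^ 2 * X 1 + X 1 ^ 2 * X 2 + X 2 ^ 2 * X 0) := by
    rw [hg]
    ring
  have h30 : (3 : Fin 4) ≠ 0 := by decide
  have h31 : (3 : Fin 4) ≠ 1 := by decide
  have h32 : (3 : Fin 4) ≠ 2 := by decide
  -- `X₃` occurs neither in `a` nor in `c`
  have hva : (3 : Fin 4) ∉ (X 0 + X 1 * X 2 : MvPolynomial (Fin 4) k).vars :=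
    notMem_vars_add (notMem_vars_X h30) (notMem_vars_mul (notMem_vars_X h31) (notMem_vars_X h32))
  have hvc : (3 : Fin 4) ∉
      (X 0 ^ 2 * X 1 + X 1 ^ 2 * X 2 + X 2 ^ 2 * X 0 : MvPolynomial (Fin 4) k).vars :=
    notMem_vars_add (notMem_vars_add
        (notMem_vars_mul (notMem_vars_pow (notMem_vars_X h30) 2) (notMem_vars_X h31))
        (notMem_vars_mul (notMem_vars_pow (notMem_vars_X h31) 2) (notMem_vars_X h32)))
      (notMem_vars_mul (notMem_vars_pow (notMem_vars_X h32) 2) (notMem_vars_X h30))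
  -- `a = 1 · X₀ + X₁X₂` is irreducible: linear in `X₀` with coprime coefficients `1`, `X₁X₂`
  have hirra : Irreducible (X 0 + X 1 * X 2 : MvPolynomial (Fin 4) k) := by
    have h := irreducible_mul_X_add (1 : MvPolynomial (Fin 4) k) (X 1 * X 2) 0 one_ne_zero
      (by rw [vars_one]; exact Finset.notMem_empty _)
      (notMem_vars_mul (notMem_vars_X (by decide)) (notMem_vars_X (by decide)))
      isRelPrime_one_left
    rwa [one_mul] at h
  -- `a ∤ c`: at `(X₀,X₁,X₂,X₃) = (-1,1,1,0)` the form `a` vanishes but `c = 1`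
  have hndvd : ¬ (X 0 + X 1 * X 2 : MvPolynomial (Fin 4) k) ∣
      X 0 ^ 2 * X 1 + X 1 ^ 2 * X 2 + X 2 ^ 2 * X 0 := by
    intro h
    have h1 := map_dvd (MvPolynomial.eval (![-1, 1, 1, 0] : Fin 4 → k)) h
    have ha : MvPolynomial.eval (![-1, 1, 1, 0] : Fin 4 → k) (X 0 + X 1 * X 2) = 0 := by
      simp
    have hc : MvPolynomial.eval (![-1, 1, 1, 0] : Fin 4 → k)
        (X 0 ^ 2 * X 1 + X 1 ^ 2 * X 2 + X 2 ^ 2 * X 0) = 1 := by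
      simp
    rw [ha, hc, zero_dvd_iff] at h1
    exact one_ne_zero h1
  have hrel : IsRelPrime (X 0 + X 1 * X 2 : MvPolynomial (Fin 4) k)
      (X 0 ^ 2 * X 1 + X 1 ^ 2 * X 2 + X 2 ^ 2 * X 0) :=
    hirra.isRelPrime_iff_not_dvd.mpr hndvd
  have hirr : Irreducible g₃ := by
    rw [hlin]
    exact irreducible_mul_X_add _ _ 3 hirra.ne_zero hva hvc hrel
  have hprime : Prime g₃ := UniqueFactorizationMonoid.irreducible_iff_prime.mp hirr
  exact (Ideal.span_singleton_prime hprime.ne_zero).mpr hprime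

end Summit.ResolutionOfSingularities.ResolutionOfSingularities.Theorems.FInjectiveMacaulayfication.ThreefoldG3Prime
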